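import Mathlib
import Summits.Ventures.HodgeRepro.OcticCMPointSixSign
import Summits.Ventures.HodgeRepro.OcticCMPointS3ConjSymplectic

/-!
# OcticCMPointEightOddShift — no `σ`-odd primitive additive character descends to an ODD conductor at `𝔭 | 5`

Blind re-derivation cell `pub-hodge-repro`, seat night-2 (gen 5).  Target tree path
`lean/Summits/Ventures/HodgeRepro/OcticCMPointEightOddShift.lean`.  On `R8 = 𝒪/𝔭⁸` with the `σ`-odd primitive
`ψ̃₈ = ψ₂₅ ∘ top` (`OcticCMPointEightModel`), the shifted character `ψ̃₈(z ·)` is `σ`-odd (`ψ̃₈(z σ(y)) = ψ̃₈(−z y)`)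
**iff `σ(z) = z`** (`psiTilde_shift_conj_iff`: primitivity of `ψ̃₈`).  The characters of `𝒪/𝔭^c` are the shifts by
`z ∈ (w^{8−c})`, primitive ones by `z = w^{8−c} u` with `u` a unit; for `c` EVEN `w^{8−c}` is `σ`-fixed and the
descended `ψ̃_c` is `σ`-odd (`c = 6`: `OcticCMPointSixModel.psi6_conj6`); for `c` ODD, `w^{8−c} u` is never `σ`-fixed
(`conj_w_cube_mul_unit_ne`, `conj_w_mul_unit_ne`, `conj_w_pow_five_mul_unit_ne`: `σ(w^k u) − w^k u = −w^k (u + σ u)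
= −2 w^k · evenPart u`, whose lowest coordinate is `2 c₀ ≢ 0 mod 5` for a unit), hence
**`no_conjOdd_shift_odd_conductor`: no `σ`-odd primitive additive character of `𝒪/𝔭^c` exists for `c ∈ {3, 5, 7}`**.
Consequence for the odd conductors: the descended character is `σ`-EVEN, the conjugate-dual stationary point is
`σ`-ANTI-fixed mod `I`, and the even-conductor machinery (`LocalChar.conj_sub_mem`, `eps_eq_of_conjDual`) must be
re-derived with `ψ ∘ σ = ψ` — the honest reason the odd rows are not in this cell's table.

**What this is not.**  No root number at an odd conductor is computed here.  Nothing here says anything about the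
status of the Hodge conjecture for CM abelian varieties, which is NOT proved.
-/

set_option autoImplicit false

noncomputable section

open Polynomial Classical

namespace Summit.Ventures.HodgeRepro.PeriodCloser

namespace EightModel

open GaussSumStability SixModel

/-- **A shift of `ψ̃₈` is `σ`-odd iff the shift is `σ`-fixed.** -/
theorem psiTilde_shift_conj_iff (z : R8) :
    (∀ y, psiTilde (z * conj y) = psiTilde (-(z * y))) ↔ conj z = z := by
  constructor
  · intro h
    apply mulShift_psiTilde_injective
    ext y
    rw [AddChar.mulShift_apply, AddChar.mulShift_apply]
    have := h (conj y)
    rw [conj_conj] at this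
    -- `ψ̃₈(−z σ(y)) = ψ̃₈(σ(−σ(z) y)) = ψ̃₈(σ(z) y)`
    rw [this, show -(z * conj y) = conj (-(conj z * y)) by
      rw [map_neg, map_mul, conj_conj], psiTilde_conj, neg_neg]
  · intro hz y
    rw [← hz, ← map_mul, psiTilde_conj, hz]

/-- `u + σ(u) = 2 · evenPart u`. -/
theorem add_conj_eq (u : R8) : u + conj u = 2 * evenPart u := by
  have h := conj_sub_self u
  have h2 := evenPart_add_oddPart u
  linear_combination h - 2 * h2

/-- The `1`-coordinate of `evenPart u` is the `1`-coordinate of `u`. -/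
theorem coords_evenPart (u : R8) (i : Fin 4) :
    b4.repr (evenPart u) i = ![b4.repr u 0, 0, b4.repr u 2, 0] i := by
  unfold evenPart
  rw [show (b4.repr u 0) • (1 : R8) + (b4.repr u 2) • w ^ 2 =
    (b4.repr u 0) • (1 : R8) + (0 : ZMod 25) • w + (b4.repr u 2) • w ^ 2 + (0 : ZMod 25) • w ^ 3 by simp,
    coords_comb]

/-- **`w³ u` is not `σ`-fixed for a unit `u`** (the shift of conductor `5`). -/
theorem conj_w_cube_mul_unit_ne (u : R8ˣ) : conj (w ^ 3 * u) ≠ w ^ 3 * u := by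
  intro h
  have h1 : w ^ 3 * (2 * evenPart (u : R8)) = 0 := by
    have := add_conj_eq (u : R8)
    rw [map_mul, map_pow, conj_w] at h
    linear_combination (-1 : R8) * h - w ^ 3 * this
  rw [show (2 : R8) * evenPart (u : R8) = (2 * b4.repr (u : R8) 0) • (1 : R8) + (0 : ZMod 25) • w +
      (2 * b4.repr (u : R8) 2) • w ^ 2 + (0 : ZMod 25) • w ^ 3 by
      unfold evenPart; simp only [smul_eq_num, map_mul, map_ofNat, map_zero]; ring,
    w_cube_mul_comb, eq_zero_iff_coords] at h1
  obtain ⟨-, -, -, h3⟩ := h1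
  -- `2 c₀ + 20 (2 c₂) = 0` forces `c₀ ≡ 0 mod 5`, contradicting `res u ≠ 0`
  apply res_ne_zero_of_isUnit u
  unfold res
  have key : ∀ a b : ZMod 25, 2 * a + 20 * (2 * b) = 0 → c5 a = 0 := by decide
  exact key _ _ h3

/-- **`w u` is not `σ`-fixed for a unit `u`** (the shift of conductor `7`). -/
theorem conj_w_mul_unit_ne (u : R8ˣ) : conj (w * u) ≠ w * u := by
  intro h
  have h1 : w * (2 * evenPart (u : R8)) = 0 := by
    have := add_conj_eq (u : R8)
    rw [map_mul, conj_w] at h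
    linear_combination (-1 : R8) * h - w * this
  have hw : w * (2 * evenPart (u : R8)) = (0 : ZMod 25) • (1 : R8) + (2 * b4.repr (u : R8) 0) • w +
      (0 : ZMod 25) • w ^ 2 + (2 * b4.repr (u : R8) 2) • w ^ 3 := by
    unfold evenPart; simp only [smul_eq_num, map_mul, map_ofNat, map_zero]; ring
  rw [hw, eq_zero_iff_coords] at h1
  obtain ⟨-, h2, -, -⟩ := h1
  apply res_ne_zero_of_isUnit u
  unfold res
  have key : ∀ a : ZMod 25, 2 * a = 0 → c5 a = 0 := by decide
  exact key _ h2

/-- **`w⁵ u` is not `σ`-fixed for a unit `u`** (the shift of conductor `3`). -/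
theorem conj_w_pow_five_mul_unit_ne (u : R8ˣ) : conj (w ^ 5 * u) ≠ w ^ 5 * u := by
  intro h
  have h1 : w ^ 5 * (2 * evenPart (u : R8)) = 0 := by
    have := add_conj_eq (u : R8)
    rw [map_mul, map_pow, conj_w] at h
    linear_combination (-1 : R8) * h - w ^ 5 * this
  rw [show (2 : R8) * evenPart (u : R8) = (2 * b4.repr (u : R8) 0) • (1 : R8) + (0 : ZMod 25) • w +
      (2 * b4.repr (u : R8) 2) • w ^ 2 + (0 : ZMod 25) • w ^ 3 by
      unfold evenPart; simp only [smul_eq_num, map_mul, map_ofNat, map_zero]; ring,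
    w_five_mul_comb, eq_zero_iff_coords] at h1
  obtain ⟨-, h2, -, -⟩ := h1
  apply res_ne_zero_of_isUnit u
  unfold res
  have key : ∀ a : ZMod 25, 20 * (2 * a) = 0 → c5 a = 0 := by decide
  exact key _ h2

/-- **No `σ`-odd primitive additive character at an odd conductor**: for `k ∈ {1, 3, 5}` (conductors `7, 5, 3`) and a
unit `u`, the shift `ψ̃₈(w^k u ·)` — the general primitive character of `𝒪/𝔭^{8−k}` — is not `σ`-odd. -/
theorem no_conjOdd_shift_odd_conductor (u : R8ˣ) :
    (¬ ∀ y, psiTilde (w * u * conj y) = psiTilde (-(w * u * y))) ∧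
    (¬ ∀ y, psiTilde (w ^ 3 * u * conj y) = psiTilde (-(w ^ 3 * u * y))) ∧
    (¬ ∀ y, psiTilde (w ^ 5 * u * conj y) = psiTilde (-(w ^ 5 * u * y))) :=
  ⟨fun h => conj_w_mul_unit_ne u ((psiTilde_shift_conj_iff _).1 h),
    fun h => conj_w_cube_mul_unit_ne u ((psiTilde_shift_conj_iff _).1 h),
    fun h => conj_w_pow_five_mul_unit_ne u ((psiTilde_shift_conj_iff _).1 h)⟩

/-- For contrast, the even shifts are `σ`-fixed: `σ(w²) = w²`, `σ(w⁴) = w⁴`, `σ(w⁶) = w⁶`. -/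
theorem conj_w_even_pow (k : ℕ) : conj (w ^ (2 * k)) = w ^ (2 * k) := by
  rw [map_pow, conj_w, pow_mul, pow_mul, neg_sq]

end EightModel

end Summit.Ventures.HodgeRepro.PeriodCloser

end
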